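import Summits.ValiantsHypothesis.ValiantsHypothesis.Theorems.KPlusLogSqLawTropicalBTopHeavyCoreSwaps

/-!
# Route «KPlusLogSqLaw», crux `TropicalB` (stmt-ValiantsHypothesis-19771) — THE SYMMETRIC TRANSFER LAW, and
# THE (2,2)→(1,3) TRANSFER LAW FOR EVERY THREE-VALUED `A` IN EVERY ARRANGEMENT

HONEST FRAMING.  Helper file (cell `pub-symmetroid`, seat val-sym-trop-p1 g23, 2026-08-29; `--supports stmt-ValiantsHypothesis-19771 --as
helper`), sequel of …TopHeavyCoreSwaps (same seat).  Census-STRUCTURE laws of the κ-programme (3-body obstructions on dominant terms of an arbitrary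
dominance design, every size `m`); nothing here bounds `TropicalB` in its window and nothing bears on `WeakLifting`, DoorA26 / DoorA34,
`MatrixDescartes` (stmt-ValiantsHypothesis-18050) or VP ≠ VNP.  As for every law sharing the `C`-histogram `c₀^{m−1}c₄` with CORE LAW C, no new
deficient census cell follows by itself; the content is the all-arrangement structure law.

1. `transfer_symmetric` — **THE SYMMETRIC TRANSFER LAW.**  `P_C` latest, `λC ≡ c₀` off one column, all classes of `P_A`, `P_B` above `c₀`.  IF
   (B1) some RAISED column `b` (`d (λA b) < d (λB b)`) has `B`-surplus `d (λB b) − d c₀ ≥` every deficit `d (λA j) − d (λB j)`, AND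
   (A1′) some LOWERED column `u` (`d (λB u) < d (λA u)`) has `A`-surplus `d (λA u) − d c₀ ≥` every raise `d (λB j) − d (λA j)`,
   THEN the three are not all dominant.  Proof: `P_B` earlier — unprimed arc through `c` avoiding `b` (`exists_arc`, `b` is moved by
   `moved_of_raised`), condition = (B1); `P_A` earlier — the SAME argument for the pair `(P_B, P_A)` (primed family, arc avoiding `u`, which is moved
   by `moved_of_lowered`), condition = (A1′).  No counting, no (A2)/(A3): the mirror image of (B1) suffices whenever the top LOWERED class is as high
   as the top RAISED class (e.g. both `c₃`).
2. `transfer_threeValued` — **THE (2,2)→(1,3) TRANSFER LAW, THREE-VALUED `A`, EVERY ARRANGEMENT**: `d c₀ < d c₁ < d c₂ < d c₃`; `λA`, `λB` with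
   values in `{c₁, c₂, c₃}` and histograms related by `B = A − 2c₂ + c₁ + c₃` (stated as counts: `#{λB = c₁} = #{λA = c₁} + 1`,
   `#{λB = c₃} = #{λA = c₃} + 1`); `P_C` `c₀`-heavy and latest ⇒ not all dominant.  CASE I (some `c₃`-column of `A` is lowered): symmetric law
   with `u` = that column and `b` = a column raised into `c₃` (exists by the `c₃`-count).  CASE II (every `c₃`-column of `A` stays): the unique new
   `c₃`-column `s` is the big raise and all other changes are `c₁ ↔ c₂` swaps with `#lowered = #raised + 1 + [λA s = c₁]` (the `c₁`-count) —
   the SWAP LAW `transfer_swaps` (…TopHeavyCoreSwaps).  This completes the lineage's «(2,2)→(1,3) TRANSFER CONJECTURE» (memo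
   HOME/val-sym-trop-p1/g21/CORE-LAW-C-g21.md §6: «for ANY class multiset `A` on `{c₁,c₂,c₃}` containing `c₂` twice … located `m ≤ 4`, 0
   counterexamples; open») as a theorem for every `m` and every arrangement; located beforehand at `m = 4` for the three arrangements not covered by
   the swap law (`A = c₃c₂c₂c₁` against `B ∈ {1331, 1133, 1313}`, all `σA, σB ∈ S₄`, all positions of `c₄`: 2304/2304 infeasible per exponent
   vector, both slope orders; seat folder tools/kt/arr4.py).
[this cell; combinatorics folklore]
-/

set_option linter.dupNamespace false
set_option autoImplicit false

namespace Summit.ValiantsHypothesis.ValiantsHypothesis.Theorems.KPlusLogSqLaw.TopHeavyCore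

open Summit.ValiantsHypothesis.ValiantsHypothesis.Theorems.MatrixDescartes.Negative
open scoped BigOperators
open Finset

variable {m K : ℕ}

/-! ## 1. The symmetric transfer law -/

/-- one half of the symmetric law: if the EARLIER of `P_A`, `P_B` is `P_B` and (B1) holds, contradiction (unprimed arc avoiding `b`). -/
theorem transfer_half (d : Fin K → ℕ) (v ε : Fin m → Fin m → Fin K → ℤ) (hm : 2 ≤ m)
    {c₀ : Fin K} {σA σB σC : Equiv.Perm (Fin m)} {lA lB lC : Fin m → Fin K} {c : Fin m}
    (hlC : ∀ x, x ≠ c → lC x = c₀) (hCge : ∀ x, d c₀ ≤ d (lC x)) (hlowA : ∀ x, d c₀ < d (lA x)) (hlowB : ∀ x, d c₀ < d (lB x))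
    {θA θB θC : ℤ} (hA : IsDominant d v ε θA (σA, lA)) (hB : IsDominant d v ε θB (σB, lB)) (hC : IsDominant d v ε θC (σC, lC))
    (hAC : θA < θC) (hBC : θB < θC) (hBA : θB < θA)
    (hB1 : ∃ b, d (lA b) < d (lB b) ∧ ∀ j, (d (lA j) : ℤ) - d (lB j) ≤ (d (lB b) : ℤ) - d c₀) : False := by
  classical
  obtain ⟨b, hbr, hbud⟩ := hB1
  have hbτ : (σA⁻¹ * σB) b ≠ b := moved_of_raised d v ε hA hB hBA hbr
  obtain ⟨hfix, hcyc⟩ := cycle_CX d v ε hBC hB hC c hlC hlowB hm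
  set P : Equiv.Perm (Fin m) := σC⁻¹ * σB with hPdef
  set τ : Equiv.Perm (Fin m) := σA⁻¹ * σB with hτdef
  obtain ⟨Uf, hUF⟩ := exists_arcFamily P τ hfix hcyc
  obtain ⟨j, hj, hcU, hbU⟩ := exists_arc P τ hfix hcyc Uf hUF b c hbτ
  obtain ⟨hjU, hfirst, hcard, hstart, hstep, -, -⟩ := hUF j hj
  set U := Uf j with hUdef
  have hUne : U ≠ univ := by rintro h; rw [h, card_univ, Fintype.card_fin] at hcard; exact lt_irrefl _ hcard
  have hinj := oneJump_injective hPdef hτdef hfirst hstart hstep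
  refine core_of_oneJump d v ε hm hlC hCge hlowA hlowB hA hB hC hAC hBC (ne_of_gt hBA) U j hjU hcU hUne hinj
    (fun h => absurd hBA (lt_asymm h)) ?_
  intro _
  have hlowB' : ∑ _x ∈ Uᶜ, (d c₀ : ℤ) ≤ ∑ x ∈ Uᶜ, (d (lB x) : ℤ) :=
    Finset.sum_le_sum fun x _ => by exact_mod_cast (hlowB x).le
  rcases hbU with hbU | hbj
  · have h1 : (d (lB b) : ℤ) - d c₀ ≤ ∑ x ∈ Uᶜ, (d (lB x) : ℤ) - ∑ _x ∈ Uᶜ, (d c₀ : ℤ) := by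
      rw [← Finset.sum_sub_distrib]
      refine Finset.single_le_sum (f := fun x => (d (lB x) : ℤ) - d c₀) (fun x _ => ?_) (mem_compl.mpr hbU)
      have : (d c₀ : ℤ) ≤ d (lB x) := by exact_mod_cast (hlowB x).le
      linarith
    have h2 := hbud j
    linarith
  · subst hbj
    have h2 : (d (lA b) : ℤ) < d (lB b) := by exact_mod_cast hbr
    linarith

/-- **THE SYMMETRIC TRANSFER LAW.**  See the module docstring, item 1. [this cell] -/
theorem transfer_symmetric (d : Fin K → ℕ) (v ε : Fin m → Fin m → Fin K → ℤ)
    {c₀ : Fin K} {σA σB σC : Equiv.Perm (Fin m)} {lA lB lC : Fin m → Fin K} {c : Fin m}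
    (hlC : ∀ x, x ≠ c → lC x = c₀) (hCge : ∀ x, d c₀ ≤ d (lC x)) (hlowA : ∀ x, d c₀ < d (lA x)) (hlowB : ∀ x, d c₀ < d (lB x))
    {θA θB θC : ℤ} (hA : IsDominant d v ε θA (σA, lA)) (hB : IsDominant d v ε θB (σB, lB)) (hC : IsDominant d v ε θC (σC, lC))
    (hAC : θA < θC) (hBC : θB < θC)
    (hB1 : ∃ b, d (lA b) < d (lB b) ∧ ∀ j, (d (lA j) : ℤ) - d (lB j) ≤ (d (lB b) : ℤ) - d c₀)
    (hA1 : ∃ u, d (lB u) < d (lA u) ∧ ∀ j, (d (lB j) : ℤ) - d (lA j) ≤ (d (lA u) : ℤ) - d c₀) : False := by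
  classical
  obtain ⟨b, hbr, hbud⟩ := hB1
  obtain ⟨u, hul, huud⟩ := hA1
  -- `P_A ≠ P_B`, `θA ≠ θB`, `m ≥ 2`
  have hABne : ((σA, lA) : Equiv.Perm (Fin m) × (Fin m → Fin K)) ≠ (σB, lB) := by
    intro h
    have : lA u = lB u := by rw [(Prod.mk.inj h).2]
    rw [this] at hul; exact lt_irrefl _ hul
  have hAB : θA ≠ θB := by
    rintro rfl
    exact lt_asymm (hA.2 _ (Ne.symm hABne) hB.1) (hB.2 _ hABne hA.1)
  have hub : u ≠ b := by rintro rfl; exact lt_asymm hul hbr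
  have hm : 2 ≤ m := by
    have h := card_le_card (subset_univ ({u, b} : Finset (Fin m)))
    rw [card_pair hub, card_univ, Fintype.card_fin] at h; exact h
  rcases lt_or_gt_of_ne hAB with hlt | hgt
  · -- `P_A` earlier: the half-law for the pair `(P_B, P_A)` with the lowered column `u` as its raised column
    exact transfer_half d v ε hm hlC hCge hlowB hlowA hB hA hC hBC hAC hlt ⟨u, hul, huud⟩
  · exact transfer_half d v ε hm hlC hCge hlowA hlowB hA hB hC hAC hBC hgt ⟨b, hbr, hbud⟩

/-! ## 2. The (2,2)→(1,3) transfer law for three-valued `A`, every arrangement -/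

/-- **THE (2,2)→(1,3) TRANSFER LAW, THREE-VALUED `A`, EVERY ARRANGEMENT.**  See the module docstring, item 2. [this cell] -/
theorem transfer_threeValued (d : Fin K → ℕ) (v ε : Fin m → Fin m → Fin K → ℤ)
    {c₀ c₁ c₂ c₃ : Fin K} (h01 : d c₀ < d c₁) (h12 : d c₁ < d c₂) (h23 : d c₂ < d c₃)
    {σA σB σC : Equiv.Perm (Fin m)} {lA lB lC : Fin m → Fin K} {c : Fin m}
    (hvA : ∀ x, lA x = c₁ ∨ lA x = c₂ ∨ lA x = c₃) (hvB : ∀ x, lB x = c₁ ∨ lB x = c₂ ∨ lB x = c₃)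
    (hc1 : (univ.filter fun x => lB x = c₁).card = (univ.filter fun x => lA x = c₁).card + 1)
    (hc3 : (univ.filter fun x => lB x = c₃).card = (univ.filter fun x => lA x = c₃).card + 1)
    (hlC : ∀ x, x ≠ c → lC x = c₀) (hCge : ∀ x, d c₀ ≤ d (lC x))
    {θA θB θC : ℤ} (hA : IsDominant d v ε θA (σA, lA)) (hB : IsDominant d v ε θB (σB, lB)) (hC : IsDominant d v ε θC (σC, lC))
    (hAC : θA < θC) (hBC : θB < θC) : False := by
  classical
  have hc13 : c₁ ≠ c₃ := fun e => by rw [e] at h12; exact lt_asymm h12 h23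
  have hc23 : c₂ ≠ c₃ := fun e => by rw [e] at h23; exact lt_irrefl _ h23
  have hc12 : c₁ ≠ c₂ := fun e => by rw [e] at h12; exact lt_irrefl _ h12
  -- exponent bounds
  have hAge : ∀ x, d c₁ ≤ d (lA x) := fun x => by
    rcases hvA x with h | h | h <;> rw [h]
    · exact h12.le
    · exact (h12.trans h23).le
  have hAle : ∀ x, d (lA x) ≤ d c₃ := fun x => by
    rcases hvA x with h | h | h <;> rw [h]
    · exact (h12.trans h23).le
    · exact h23.le
  have hBge : ∀ x, d c₁ ≤ d (lB x) := fun x => by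
    rcases hvB x with h | h | h <;> rw [h]
    · exact h12.le
    · exact (h12.trans h23).le
  have hBle : ∀ x, d (lB x) ≤ d c₃ := fun x => by
    rcases hvB x with h | h | h <;> rw [h]
    · exact (h12.trans h23).le
    · exact h23.le
  have hlowA : ∀ x, d c₀ < d (lA x) := fun x => lt_of_lt_of_le h01 (hAge x)
  have hlowB : ∀ x, d c₀ < d (lB x) := fun x => lt_of_lt_of_le h01 (hBge x)
  -- a column raised INTO `c₃` always exists (the `c₃`-count of `B` exceeds that of `A`)
  have hraise3 : ∃ b, lB b = c₃ ∧ lA b ≠ c₃ := by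
    by_contra h
    push Not at h
    have hsub : (univ.filter fun x => lB x = c₃) ⊆ (univ.filter fun x => lA x = c₃) := by
      intro x hx
      exact mem_filter.mpr ⟨mem_univ _, h x (mem_filter.mp hx).2⟩
    have := card_le_card hsub
    omega
  by_cases hI : ∃ u, lA u = c₃ ∧ lB u ≠ c₃
  · -- CASE I: a lowered `c₃`-column `u`; symmetric law with `b` raised into `c₃`
    obtain ⟨u, hAu, hBu⟩ := hI
    obtain ⟨b, hBb, hAb⟩ := hraise3
    have hbr : d (lA b) < d (lB b) := by
      rw [hBb]; exact lt_of_le_of_ne (hAle b) (fun e => hAb (by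
        rcases hvA b with h | h | h
        · rw [h] at e; exact absurd e (ne_of_lt (h12.trans h23))
        · rw [h] at e; exact absurd e (ne_of_lt h23)
        · exact h))
    have hul : d (lB u) < d (lA u) := by
      rw [hAu]; exact lt_of_le_of_ne (hBle u) (fun e => hBu (by
        rcases hvB u with h | h | h
        · rw [h] at e; exact absurd e (ne_of_lt (h12.trans h23))
        · rw [h] at e; exact absurd e (ne_of_lt h23)
        · exact h))
    refine transfer_symmetric d v ε hlC hCge hlowA hlowB hA hB hC hAC hBC ⟨b, hbr, fun j => ?_⟩ ⟨u, hul, fun j => ?_⟩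
    · rw [hBb]
      have h1 : (d (lA j) : ℤ) ≤ d c₃ := by exact_mod_cast hAle j
      have h2 : (d c₀ : ℤ) < d (lB j) := by exact_mod_cast hlowB j
      linarith
    · rw [hAu]
      have h1 : (d (lB j) : ℤ) ≤ d c₃ := by exact_mod_cast hBle j
      have h2 : (d c₀ : ℤ) < d (lA j) := by exact_mod_cast hlowA j
      linarith
  · -- CASE II: every `c₃`-column of `A` keeps `c₃`; the unique new `c₃`-column `s` is the big raise, all other changes are `c₁ ↔ c₂` swaps
    push Not at hI
    obtain ⟨s, hBs, hAs⟩ := hraise3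
    -- uniqueness of the new `c₃`-column
    have huniq : ∀ x, x ≠ s → lB x = c₃ → lA x = c₃ := by
      intro x hxs hBx
      by_contra hAx
      -- then `{λA = c₃} ∪ {s, x} ⊆ {λB = c₃}`, two more than allowed
      have hsub : insert s (insert x (univ.filter fun y => lA y = c₃)) ⊆ (univ.filter fun y => lB y = c₃) := by
        intro y hy
        rw [mem_insert, mem_insert] at hy
        rcases hy with rfl | rfl | hy
        · exact mem_filter.mpr ⟨mem_univ _, hBs⟩
        · exact mem_filter.mpr ⟨mem_univ _, hBx⟩
        · exact mem_filter.mpr ⟨mem_univ _, hI y (mem_filter.mp hy).2⟩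
      have hx' : x ∉ (univ.filter fun y => lA y = c₃) := fun h => hAx (mem_filter.mp h).2
      have hs' : s ∉ insert x (univ.filter fun y => lA y = c₃) := by
        rw [mem_insert]; rintro (h | h)
        · exact hxs h.symm
        · exact hAs (mem_filter.mp h).2
      have h1 := card_le_card hsub
      rw [card_insert_of_notMem hs', card_insert_of_notMem hx'] at h1
      omega
    refine transfer_swaps d v ε h01 h12 (s := s) hlowA hlowB (fun x hxs hne => ?_) ?_ ?_ (by rw [hBs]; exact h23.le) hlC hCge hA hB hC hAC hBC
    · -- off `s`, changes are `c₁ ↔ c₂` swaps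
      have hA3 : lA x ≠ c₃ := fun h => hne (by rw [h, hI x h])
      have hB3 : lB x ≠ c₃ := fun h => hA3 (huniq x hxs h)
      rcases hvA x with ha | ha | ha
      · rcases hvB x with hb | hb | hb
        · exact absurd (ha.trans hb.symm) hne
        · exact Or.inl ⟨ha, hb⟩
        · exact absurd hb hB3
      · rcases hvB x with hb | hb | hb
        · exact Or.inr ⟨ha, hb⟩
        · exact absurd (ha.trans hb.symm) hne
        · exact absurd hb hB3
      · exact absurd ha hA3
    · -- the count `#X + 1 ≤ #Y` from the `c₁`-count
      set X : Finset (Fin m) := univ.filter fun x => x ≠ s ∧ lA x = c₁ ∧ lB x = c₂ with hX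
      set Y : Finset (Fin m) := univ.filter fun x => x ≠ s ∧ lA x = c₂ ∧ lB x = c₁ with hY
      set W : Finset (Fin m) := univ.filter fun x => lA x = c₁ ∧ lB x = c₁ with hW
      -- `{λB = c₁} ⊆ W ∪ Y`
      have hB1 : (univ.filter fun x => lB x = c₁) ⊆ W ∪ Y := by
        intro x hx
        have hBx := (mem_filter.mp hx).2
        rw [mem_union]
        rcases hvA x with ha | ha | ha
        · exact Or.inl (mem_filter.mpr ⟨mem_univ _, ha, hBx⟩)
        · refine Or.inr (mem_filter.mpr ⟨mem_univ _, fun h => ?_, ha, hBx⟩)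
          rw [h, hBs] at hBx; exact hc13.symm hBx
        · exact absurd ((hI x ha).symm.trans hBx) hc13.symm
      -- `W ∪ X ⊆ {λA = c₁}`, disjointly
      have hA1 : W ∪ X ⊆ (univ.filter fun x => lA x = c₁) := by
        intro x hx
        rw [mem_union] at hx
        rcases hx with hx | hx
        · exact mem_filter.mpr ⟨mem_univ _, (mem_filter.mp hx).2.1⟩
        · exact mem_filter.mpr ⟨mem_univ _, (mem_filter.mp hx).2.2.1⟩
      have hWX : Disjoint W X := by
        rw [Finset.disjoint_left]
        intro x hxW hxX
        have h1 := (mem_filter.mp hxW).2.2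
        have h2 := (mem_filter.mp hxX).2.2.2
        exact hc12 (h1.symm.trans h2)
      have e1 := card_le_card hB1
      have e2 := (card_union_le W Y)
      have e3 := card_le_card hA1
      rw [card_union_of_disjoint hWX] at e3
      omega
    · rw [hBs]; exact lt_of_le_of_ne (hAle s) (fun e => hAs (by
        rcases hvA s with h | h | h
        · rw [h] at e; exact absurd e (ne_of_lt (h12.trans h23))
        · rw [h] at e; exact absurd e (ne_of_lt h23)
        · exact h))

end Summit.ValiantsHypothesis.ValiantsHypothesis.Theorems.KPlusLogSqLaw.TopHeavyCore
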